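import Summits.QuantumFields.BalabanUV.T4Continuum.Spine.NE1p.DressedSmallFieldOnCores
import Summits.QuantumFields.BalabanUV.T4Continuum.Spine.NE1p.DressedSmallFieldTorusWitness

/-!
# T⁴ programme, spine estimate NE1′ (node O3b/H2) — WITNESS W31: THE OWNER's N0p ENDs («(B1)'s ANALYTIC HALF DISCHARGED BY ROW NE5's
# STRUCTURAL SHAPE») FIRE ON BAŁABAN'S PERIODIC CARRIER WITH A GENUINE EXP-LINEAR TERM FAMILY — `attachedPart_locE_le_of_expLinear`
# and `muPart_locE_le_of_expLinear` ONCE EACH BY NAME at `G := tgeometry 4 N`, `hexp` a THEOREM-backed instance of `TermHistExpLinear`,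
# (B3)'s parameter-mass budget met WITH EQUALITY, the bounded quantities `≠ 0`

Cell `pub-balaban`, sub-cell `t4`, BINDER-OWNERS row NE1′, crew `b2b-balaban-t4-ne1p-formalise-*`, seat `…-leaf-06` (gen 8; lineage
S7b∕S7c∕S8∕W4s∕W22∕W26); typer R-T108 (ii), DAG N29zj.  ADDITIVE — imports the owner's N0p `Spine/NE1p/DressedSmallFieldOnCores`
(t4-ne1p-p1 g27) and W24 `Spine/NE1p/DressedSmallFieldTorusWitness` (leaf-04-g10) ONLY; toy DATA `def`s + theorems; 0 `def … : Prop`,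
0 cite tags, 0 sorry; nothing of N0p ∕ N0o ∕ W24 ∕ row NE5's modules is restated — their declarations are used BY NAME.

WHY.  N0p's §3 ENDs take row NE5's structural shape `hexp : TermHistExpLinear …` («every term is `∫ Φ(a)·exp(Λ(a) h) dμ(a)`, table-free
data») in place of N0j∕N0k's per-polymer binders (E1) `hhol` ∕ (E2) `hm`, plus pencil ∕ class ∕ indexing ∕ read-out sockets and (B3) `hL3`
ON PARAMETER MASSES.  N0p's own §5 fires §1's PER-TERM (E1) on row NE5's toy; the §3 ENDs are exercised by no file, and NE5's toy terms
(parameter mass `≥ 2`) cannot meet `hL3` against any located clause (`A ≤ (e·K₀νc₁)⁻¹ ≤ 1`) — hence this decided SMALL-weight family (§1: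
ONE term over `toyCarriers` that READS THE TABLE, `T(o, h) = c·exp(h)`, Dirac parameter mass, `TermHistExpLinear` BY THEOREM for every
class and window), its activity of record on `tsys 4 N` (§2: the term on W24's one-cube domain `X₀` only, linear pencil `s ↦ s·w₀` inside
row NE5's ball class, weight `cW ϱ w₀ := A·e^{−ϱ‖w₀‖}` with `A := (e·K₀(64,8)·9·64)⁻¹` W24's located letter, `hL3` against `torusTreeLen`
with EQUALITY at `X₀` — decay factor `1` by `TreeLengthTorus.torusTreeLen_singleton`, as in W24's `hL3_torus`), the two ENDs fired ONCE
EACH BY NAME with W24's `hsmall_torus` ∕ `hrate_torus` at `r₁ = b = 0`, `R = 2κ₀ + 2` and their closed forms `2·K₀(64,8)` ∕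
`K₀(64,8)·μ₀∕(μ₁ − μ₀)` (§3a∕§3b), and the liveness of both bounded quantities for every live table direction via W24's `exp_locE_cube`
(§4; `e^{z} = 1` is impossible for `0 < ‖z‖ ≤ 2 < 2π`), plus N0p §2's (E2) majorant on the datum as a consistency `example`.

HONEST FRAMING (crew rules c3∕c4∕c6∕k1–k3; wording R-T108 (ii)(g)).  A WITNESS: it exercises N0p's §3 ENDs (N0o's induction ∕ μ-part
faces with (B1)'s ANALYTIC half discharged by row NE5's structural SHAPE `TermHistExpLinear`) on a DECIDED one-term exp-linear family over
the periodic carrier `tsys 4 N` (pv22's CONSTRUCTED torus geometry; READING D-pv22.3 of 𝐃_{k+1}∕d_{k+1}) — a THEOREM-backed instance of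
the SHAPE, NOT Bałaban's (2.14) terms, NOT a `BiCore` of the format of record (N0p §4's cores END `attachedPart_locE_le_of_cores` is NOT
exercised: it needs a `MeasPotFrame` read-out datum; row NE5's `termGaussianParamBi_termBi_toy` is the displayed-binders non-vacuity there).
Every constant is W24's ∕ pv22's located torus constant (`K₀(64,8)`, `ν = 9`, `c₁ = 64`, `κ₀ = 64·log 162`) or the toy's own letter; no
numeral of [Balaban1988RGII] (2.14)∕(2.18)∕(2.38)∕p. 20 is asserted; (B1b) indexing, (B3) = GAPS G-ne9p2-5 (UNPRINTED, shared with NE9),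
(B5), geometry-for-Bałaban's-densities and the step-link remain DISPLAYED; «0 binders instantiated on Bałaban's densities» UNCHANGED; no
wall item; R-t4r2-Q2 NOT met thereby; no internally-minted statement becomes a cited fact (ABSOLUTE RULE).  NE1′ ⇐ the named binders —
NOT proved, NOT printed; spine PROVED 0∕9; count 9 unchanged.  Rung (B)+1 on ONE finite four-torus — NOT infinite volume, NOT a mass
gap, NOT OS on ℝ⁴, NOT Clay.  HONEST DEPENDENCY: continuum YM on T⁴ ⇐ BetaPertH ∧ nine spine estimates (0/9 proved); BetaPertH ⇐ (D1) ∧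
(D4) ∧ CAP+tail; G-an2-4 gates asym, D1 and NE2/3/4.
-/

noncomputable section

namespace Summit.QuantumFields.BalabanUV.T4Continuum.NE1p.DressedSmallFieldOnCoresWitness

open Metric Set Complex MeasureTheory
open scoped BigOperators
open Literature.MathematicalPhysics.QuantumFieldTheory.Balaban1983to89.T4InputCauchyRate (toyCarriers)
open Literature.MathematicalPhysics.QuantumFieldTheory.Balaban1983to89.T4InputCauchyRateSpecies (ballClass toyCtr)
open Literature.MathematicalPhysics.QuantumFieldTheory.Balaban1983to89.T4InputCauchyRateTermwise (TermHistExpLinear)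
open Literature.MathematicalPhysics.QuantumFieldTheory.Balaban1983to89.B13Resummation (locE)
open Literature.MathematicalPhysics.QuantumFieldTheory.Balaban1983to89.B12TreeDecay (K₀ K₀_pos)
open Literature.MathematicalPhysics.QuantumFieldTheory.Balaban1983to89.TreeLengthTorus (TDom tsys torusTreeLen torusTreeLen_singleton)
open Literature.MathematicalPhysics.QuantumFieldTheory.Balaban1983to89.TreeLengthTorusGeometry (tgeometry TTouch)
open Summit.QuantumFields.BalabanUV.T4Continuum.NE1p.DressedSmallFieldGeometry (torus_consts)
open Summit.QuantumFields.BalabanUV.T4Continuum.NE1p.DressedSmallFieldGeometryFaces (K₀_four)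
open Summit.QuantumFields.BalabanUV.T4Continuum.NE1p.DressedSmallFieldTorusWitness (X₀ X₀_val eq_X₀_iff exp_locE_cube
  hsmall_torus hrate_torus prefactor_pos dressedConst_le_one)
open Summit.QuantumFields.BalabanUV.T4Continuum.NE1p.DressedSmallFieldOnCores (attachedPart_locE_le_of_expLinear
  muPart_locE_le_of_expLinear norm_act_le_of_terms)

/-! ## §1 THE DECIDED EXP-LINEAR TERM DATUM over row NE5's `toyCarriers` and its `TermHistExpLinear` BY THEOREM -/

/-- THE ONE-TERM FAMILY (toy DATA; index `Unit`): at every step, operator point and domain the term READS THE TABLE —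
`T(o, h) = c·exp(h)` with a real Cauchy weight `c`. [folklore] -/
def wTerm (c : ℝ) : ℕ → Unit → ℂ → ℂ → toyCarriers.Dom → ℂ := fun _ _ _ h _ => (c : ℂ) * Complex.exp h

/-- The parameter spaces: the one-point space with its Dirac mass, for the one term (toy DATA). [folklore] -/
abbrev wMeas : ℕ → Unit → ℂ → toyCarriers.Dom → Measure Unit := fun _ _ _ _ => Measure.dirac ()

/-- The history-independent Cauchy weight `Φ = c` (toy DATA). [folklore] -/
def wPhi (c : ℝ) : ℕ → Unit → ℂ → toyCarriers.Dom → Unit → ℂ := fun _ _ _ _ _ => (c : ℂ)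

/-- The read-out functional `Λ = id` (toy DATA): the exponential insertion is `exp(h)` — the term genuinely depends on the table. [folklore] -/
def wLam : ℕ → Unit → ℂ → toyCarriers.Dom → Unit → (ℂ →L[ℂ] ℂ) := fun _ _ _ _ _ => ContinuousLinearMap.id ℂ ℂ

/-- **ROW NE5's STRUCTURAL SHAPE HOLDS FOR THE DATUM — BY THEOREM**, for every input class `K` and window `W`: the weight is integrable
against the Dirac mass, the read-out weakly measurable with `‖id‖ ≤ 1`, the representation `c·exp(h) = ∫ c·exp(id h) dδ` by `integral_dirac`. [folklore] -/
theorem termHistExpLinear_wTerm (c : ℝ) (K : ℕ → (ℕ → ℝ) → toyCarriers.BgB → Set (ℂ × ℂ)) (W : Set (ℕ → ℝ)) :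
    TermHistExpLinear K (wTerm c) W (α := fun _ _ => Unit) wMeas (wPhi c) wLam := by
  intro k g _ U q _ X _ i
  refine ⟨integrable_const _, fun y => aestronglyMeasurable_const, ⟨1, ae_of_all _ fun _ => ?_⟩, ?_⟩
  · show ‖ContinuousLinearMap.id ℂ ℂ‖ ≤ 1
    exact ContinuousLinearMap.norm_id_le
  · show (c : ℂ) * Complex.exp q.2 = ∫ _a : Unit, (c : ℂ) * Complex.exp (ContinuousLinearMap.id ℂ ℂ q.2) ∂(Measure.dirac ())
    rw [integral_dirac, ContinuousLinearMap.id_apply]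

/-- The parameter mass of the one term is `|c|` (the Dirac mass is a probability measure). [folklore] -/
theorem paramMass_wPhi (c : ℝ) (k : ℕ) (i : Unit) (o : ℂ) (X : toyCarriers.Dom) :
    (∫ a, ‖wPhi c k i o X a‖ ∂wMeas k i o X) = |c| := by
  show (∫ _a : Unit, ‖(c : ℂ)‖ ∂(Measure.dirac ())) = |c|
  rw [integral_dirac, Complex.norm_real, Real.norm_eq_abs]

/-- The read-out bound `N = 1` holds everywhere (`‖id‖ ≤ 1`). [folklore] -/
theorem norm_wLam_le (k : ℕ) (i : Unit) (o : ℂ) (X : toyCarriers.Dom) (a : Unit) : ‖wLam k i o X a‖ ≤ 1 :=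
  ContinuousLinearMap.norm_id_le

/-! ## §2 THE ACTIVITY OF RECORD ON BAŁABAN'S PERIODIC CARRIER `tsys 4 N`: one term on W24's one-cube domain `X₀`, none elsewhere -/

variable (N : ℕ) [NeZero N]

/-- THE TERM INDEXING (toy DATA; the (B1b) half `hact`): the one term on the one-cube domain `X₀ = {0}`, no term elsewhere. [folklore] -/
def terms (Z : TDom 4 N) : Finset Unit := if Z.1 = {0} then Finset.univ else ∅

/-- THE DRESSED ACTIVITY ALONG THE PENCIL (toy DATA): `H_s(Z) = c·exp(s·w₀)` on `X₀`, `0` on every other torus domain —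
`s` the pencil parameter (table strength in §3a, source in §3b), `w₀ ∈ ℂ` the table direction. [folklore] -/
def actW (c : ℝ) (w₀ s : ℂ) (Z : TDom 4 N) : ℂ := if Z.1 = {0} then (c : ℂ) * Complex.exp (s * w₀) else 0

/-- The activity on `X₀`. [folklore] -/
@[simp] theorem actW_X₀ (c : ℝ) (w₀ s : ℂ) : actW N c w₀ s (X₀ N) = (c : ℂ) * Complex.exp (s * w₀) := if_pos rfl

/-- **`hact` — THE ACTIVITY IS THE SUM OF ITS TERMS** at the carrier domain `emb Z := k`, `o = 0`, pencil `hc s = s·w₀`. [folklore] -/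
theorem hact (c : ℝ) (w₀ : ℂ) (k : ℕ) (s : ℂ) (Z : TDom 4 N) :
    actW N c w₀ s Z = ∑ i ∈ terms N Z, wTerm c k i 0 (s * w₀) k := by
  unfold actW terms
  split_ifs <;> simp [wTerm]

/-- `hR` — THE TABLE RADIUS of the pencil on `‖s‖ < ϱ` is `ϱ·‖w₀‖`. [folklore] -/
theorem hR (ϱ : ℝ) (w₀ : ℂ) : ∀ s ∈ ball (0 : ℂ) ϱ, ‖s * w₀‖ ≤ ϱ * ‖w₀‖ := fun s hs => by
  rw [norm_mul]; rw [mem_ball_zero_iff] at hs; gcongr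

/-- `hK` — THE PENCIL STAYS IN ROW NE5's BALL CLASS of radii `(1/8, 2)` about `(0, 0)`: for `‖s‖ < ϱ` and `ϱ·‖w₀‖ ≤ 2`. [folklore] -/
theorem hK {ϱ : ℝ} {w₀ : ℂ} (hw : ϱ * ‖w₀‖ ≤ 2) (k : ℕ) (g : ℕ → ℝ) (U : toyCarriers.BgB) :
    ∀ s ∈ ball (0 : ℂ) ϱ, ((0 : ℂ), s * w₀) ∈ ballClass toyCtr (fun _ => 1 / 8) (fun _ => 2) k g U := fun s hs => by
  refine Set.mk_mem_prod (mem_closedBall.2 (by simp [toyCtr])) (mem_closedBall.2 ?_)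
  have h : ‖s * w₀‖ ≤ 2 := (hR ϱ w₀ s hs).trans hw
  simpa [toyCtr, dist_eq_norm] using h

/-- THE LOCATED WEIGHT: `c(ϱ, w₀) := A·e^{−ϱ‖w₀‖}` with `A := (e·K₀(64,8)·9·64)⁻¹` W24's located dressed constant (toy DATA). [folklore] -/
def cW (ϱ : ℝ) (w₀ : ℂ) : ℝ := (Real.exp 1 * K₀ 64 8 * 9 * 64)⁻¹ * Real.exp (-(ϱ * ‖w₀‖))

/-- The located weight is positive. [folklore] -/
theorem cW_pos (ϱ : ℝ) (w₀ : ℂ) : 0 < cW ϱ w₀ := mul_pos (inv_pos.2 prefactor_pos) (Real.exp_pos _)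

/-- **(B3) MET WITH EQUALITY AT `X₀`**: the one term's parameter mass times the read-out growth `e^{1·ϱ‖w₀‖}` IS `A`. [folklore] -/
theorem paramMass_X₀_eq (ϱ : ℝ) (w₀ : ℂ) (k : ℕ) :
    ∑ i ∈ terms N (X₀ N), (∫ a, ‖wPhi (cW ϱ w₀) k i 0 k a‖ ∂wMeas k i 0 k) * Real.exp (1 * (ϱ * ‖w₀‖)) =
      (Real.exp 1 * K₀ 64 8 * 9 * 64)⁻¹ := by
  have ht : terms N (X₀ N) = Finset.univ := if_pos rfl
  rw [ht, Finset.univ_unique, Finset.sum_singleton, paramMass_wPhi, abs_of_pos (cW_pos ϱ w₀), cW, one_mul, mul_assoc,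
    ← Real.exp_add, neg_add_cancel, Real.exp_zero, mul_one]

/-- **`hL3` — THE (2.38)-SHAPE OF THE PARAMETER MASSES** against `torusTreeLen`: equality at `X₀` (decay factor `1`), `0 ≤ ·` elsewhere. [folklore] -/
theorem hL3 (ϱ : ℝ) (w₀ : ℂ) (k : ℕ) (R : ℝ) :
    ∀ Z : (tsys 4 N).Dom, (tgeometry 4 N).cubes Z ⊆ (tgeometry 4 N).cubes (X₀ N) →
      ∑ i ∈ terms N Z, (∫ a, ‖wPhi (cW ϱ w₀) k i 0 k a‖ ∂wMeas k i 0 k) * Real.exp (1 * (ϱ * ‖w₀‖)) ≤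
        (Real.exp 1 * K₀ 64 8 * 9 * 64)⁻¹ * Real.exp (-(R * (tsys 4 N).dj Z)) := by
  intro Z _
  by_cases h : Z.1 = {0}
  · have hZ : Z = X₀ N := (eq_X₀_iff N Z).1 h
    subst hZ
    have hd : (tsys 4 N).dj (X₀ N) = 0 := by show torusTreeLen (X₀ N).1 = 0; rw [X₀_val]; exact torusTreeLen_singleton 0
    rw [paramMass_X₀_eq, hd, mul_zero, neg_zero, Real.exp_zero, mul_one]
  · simp only [terms, h, if_false, Finset.sum_empty]
    exact mul_nonneg (inv_nonneg.2 prefactor_pos.le) (Real.exp_pos _).le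

/-! ## §3a THE INDUCTION END OF N0p FIRES (table-strength pencil `ϱ = 2`, `A₀ = 0`, `A₁ = A/2`) -/

open Classical in
/-- **N0p's `attachedPart_locE_le_of_expLinear` APPLIED ONCE BY NAME at `G := tgeometry 4 N`**: shape `termHistExpLinear_wTerm`, window `univ`,
NE5's ball class, pencil `s ↦ s·w₀` on `‖s‖ < 2` (`‖w₀‖ ≤ 1`), read-out bound `1`, W24's `hsmall_torus`∕`hrate_torus`; conclusion LITERAL. [folklore] -/
theorem attachedEnd_fires {w₀ : ℂ} (hw : ‖w₀‖ ≤ 1) (k : ℕ) (g : ℕ → ℝ) :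
    ‖locE (tgeometry 4 N).ι (tgeometry 4 N).cubes (actW N (cW 2 w₀) w₀ 1) ((tgeometry 4 N).cubes (X₀ N)) -
        locE (tgeometry 4 N).ι (tgeometry 4 N).cubes (actW N (cW 2 w₀) w₀ 0) ((tgeometry 4 N).cubes (X₀ N))‖ ≤
      4 * (Real.exp 1 * (tgeometry 4 N).ν * (tgeometry 4 N).c₁ * (tgeometry 4 N).K₀ ^ 2) *
        ((Real.exp 1 * K₀ 64 8 * 9 * 64)⁻¹ / 2) * Real.exp (-(0 * (tsys 4 N).dj (X₀ N))) := by
  have hA : 0 ≤ (Real.exp 1 * K₀ 64 8 * 9 * 64)⁻¹ := inv_nonneg.2 prefactor_pos.le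
  have h2 : (0 : ℝ) + 2 * ((Real.exp 1 * K₀ 64 8 * 9 * 64)⁻¹ / 2) = (Real.exp 1 * K₀ 64 8 * 9 * 64)⁻¹ := by ring
  have hw2 : (2 : ℝ) * ‖w₀‖ ≤ 2 := by nlinarith [norm_nonneg w₀]
  exact attachedPart_locE_le_of_expLinear (tsys 4 N) (tgeometry 4 N)
    (termHistExpLinear_wTerm (cW 2 w₀) (ballClass toyCtr (fun _ => 1 / 8) fun _ => 2) Set.univ)
    (Set.mem_univ g) (U := ()) (o := 0) (hc := fun s : ℂ => s * w₀)
    ((differentiable_id.mul_const w₀).differentiableOn) (hK hw2 k g ()) (hR 2 w₀)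
    (emb := fun _ => k) (fun _ => rfl) (fun s _ Z => hact N (cW 2 w₀) w₀ k s Z) (N := fun _ _ => 1) (fun _ _ => zero_le_one)
    (fun _ i _ => ae_of_all _ fun a => norm_wLam_le k i 0 k a)
    (A₀ := 0) (b := 0) (R := 2 * (tgeometry 4 N).κ₀ + 2) le_rfl (by positivity) le_rfl (by rw [zero_mul])
    (hrate_torus N) (by rw [h2]; exact hsmall_torus N) (by rw [h2]; exact hL3 N 2 w₀ k _) le_rfl (by positivity)

open Classical in
/-- CLOSED FORM `≤ 2·K₀(64,8)` (`4·(e·ν·c₁·K₀²)·(A/2)·e⁰` with `e·ν·c₁·K₀²·A = K₀(64,8)` by `K₀_four`∕`torus_consts`). [folklore] -/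
theorem attachedEnd_fires' {w₀ : ℂ} (hw : ‖w₀‖ ≤ 1) (k : ℕ) (g : ℕ → ℝ) :
    ‖locE (tgeometry 4 N).ι (tgeometry 4 N).cubes (actW N (cW 2 w₀) w₀ 1) ((tgeometry 4 N).cubes (X₀ N)) -
        locE (tgeometry 4 N).ι (tgeometry 4 N).cubes (actW N (cW 2 w₀) w₀ 0) ((tgeometry 4 N).cubes (X₀ N))‖ ≤
      2 * K₀ 64 8 := by
  have h := attachedEnd_fires N hw k g
  rw [zero_mul, neg_zero, Real.exp_zero, mul_one, K₀_four, (torus_consts N).1, (torus_consts N).2.2] at h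
  refine h.trans (le_of_eq ?_)
  have hK : K₀ (64 : ℝ) 8 ≠ 0 := (K₀_pos _ _).ne'; have he : Real.exp 1 ≠ 0 := (Real.exp_pos 1).ne'
  field_simp; ring

/-! ## §3b THE μ-PART END OF N0p FIRES (source pencil `‖s‖ < μ₁`, constant `A`) -/

open Classical in
/-- **N0p's `muPart_locE_le_of_expLinear` APPLIED ONCE BY NAME at `G := tgeometry 4 N`**: the same datum read along a SOURCE pencil
`s ↦ s·w₀` on `‖s‖ < μ₁` (weight `c(μ₁, w₀)`, `μ₁·‖w₀‖ ≤ 2`), clause `hsmall_torus` LITERALLY; for `0 < μ₀ < μ₁`, `‖μ‖ ≤ μ₀`. [folklore] -/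
theorem muEnd_fires {μ₁ μ₀ : ℝ} {μ w₀ : ℂ} (hw : μ₁ * ‖w₀‖ ≤ 2) (h0 : 0 < μ₀) (h01 : μ₀ < μ₁) (hμ : ‖μ‖ ≤ μ₀)
    (k : ℕ) (g : ℕ → ℝ) :
    ‖locE (tgeometry 4 N).ι (tgeometry 4 N).cubes (actW N (cW μ₁ w₀) w₀ μ) ((tgeometry 4 N).cubes (X₀ N)) -
        locE (tgeometry 4 N).ι (tgeometry 4 N).cubes (actW N (cW μ₁ w₀) w₀ 0) ((tgeometry 4 N).cubes (X₀ N))‖ ≤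
      Real.exp 1 * (tgeometry 4 N).ν * (tgeometry 4 N).c₁ * (tgeometry 4 N).K₀ ^ 2 * (Real.exp 1 * K₀ 64 8 * 9 * 64)⁻¹ *
        Real.exp (-(0 * (tsys 4 N).dj (X₀ N))) * (μ₀ / (μ₁ - μ₀)) :=
  muPart_locE_le_of_expLinear (tsys 4 N) (tgeometry 4 N)
    (termHistExpLinear_wTerm (cW μ₁ w₀) (ballClass toyCtr (fun _ => 1 / 8) fun _ => 2) Set.univ)
    (Set.mem_univ g) (U := ()) (o := 0) (hc := fun s : ℂ => s * w₀)
    ((differentiable_id.mul_const w₀).differentiableOn) (hK hw k g ()) (hR μ₁ w₀)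
    (emb := fun _ => k) (fun _ => rfl) (fun s _ Z => hact N (cW μ₁ w₀) w₀ k s Z) (N := fun _ _ => 1) (fun _ _ => zero_le_one)
    (fun _ i _ => ae_of_all _ fun a => norm_wLam_le k i 0 k a)
    (b := 0) (R := 2 * (tgeometry 4 N).κ₀ + 2) (inv_nonneg.2 prefactor_pos.le) le_rfl (by rw [zero_mul])
    (hrate_torus N) (hsmall_torus N) (hL3 N μ₁ w₀ k _) h0 h01 hμ

open Classical in
/-- CLOSED FORM: the μ-part is `≤ K₀(64,8)·μ₀/(μ₁ − μ₀)`. [folklore] -/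
theorem muEnd_fires' {μ₁ μ₀ : ℝ} {μ w₀ : ℂ} (hw : μ₁ * ‖w₀‖ ≤ 2) (h0 : 0 < μ₀) (h01 : μ₀ < μ₁) (hμ : ‖μ‖ ≤ μ₀)
    (k : ℕ) (g : ℕ → ℝ) :
    ‖locE (tgeometry 4 N).ι (tgeometry 4 N).cubes (actW N (cW μ₁ w₀) w₀ μ) ((tgeometry 4 N).cubes (X₀ N)) -
        locE (tgeometry 4 N).ι (tgeometry 4 N).cubes (actW N (cW μ₁ w₀) w₀ 0) ((tgeometry 4 N).cubes (X₀ N))‖ ≤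
      K₀ 64 8 * (μ₀ / (μ₁ - μ₀)) := by
  have h := muEnd_fires N hw h0 h01 hμ k g
  rw [zero_mul, neg_zero, Real.exp_zero, mul_one, K₀_four, (torus_consts N).1, (torus_consts N).2.2] at h
  refine h.trans (le_of_eq ?_)
  have hK : K₀ (64 : ℝ) 8 ≠ 0 := (K₀_pos _ _).ne'; have he : Real.exp 1 ≠ 0 := (Real.exp_pos 1).ne'
  field_simp

/-! ## §4 GENUINE — the bounded quantities are NOT zero ((B3) is tight by `paramMass_X₀_eq`); N0p §2's (E2) majorant on the datum -/

/-- On `X₀` the activity has norm `< 1` STRICTLY INSIDE the pencil for a live table direction: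
`‖c(ϱ,w₀)·e^{s w₀}‖ ≤ A·e^{(‖s‖−ϱ)‖w₀‖} < A ≤ 1` (W24 `dressedConst_le_one`). [folklore] -/
theorem norm_actW_X₀_lt_one {ϱ : ℝ} {w₀ s : ℂ} (hs : ‖s‖ < ϱ) (hw0 : w₀ ≠ 0) : ‖actW N (cW ϱ w₀) w₀ s (X₀ N)‖ < 1 := by
  rw [actW_X₀, norm_mul, Complex.norm_real, Real.norm_eq_abs, abs_of_pos (cW_pos ϱ w₀), Complex.norm_exp, cW, mul_assoc,
    ← Real.exp_add]
  have hw : 0 < ‖w₀‖ := norm_pos_iff.2 hw0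
  have hre : (s * w₀).re ≤ ‖s‖ * ‖w₀‖ := (Complex.re_le_norm _).trans (norm_mul_le _ _)
  have hlt : -(ϱ * ‖w₀‖) + (s * w₀).re < 0 := by nlinarith
  calc (Real.exp 1 * K₀ 64 8 * 9 * 64)⁻¹ * Real.exp (-(ϱ * ‖w₀‖) + (s * w₀).re)
      < (Real.exp 1 * K₀ 64 8 * 9 * 64)⁻¹ * 1 := mul_lt_mul_of_pos_left (Real.exp_lt_one_iff.2 hlt) (inv_pos.2 prefactor_pos)
    _ ≤ 1 := by rw [mul_one]; exact dressedConst_le_one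

open Classical in
/-- BRIDGE to W24 (`exp_locE_cube` BY NAME; `(tgeometry 4 N).ι = TTouch`, `.cubes Z = Z.1` by `rfl`): for `‖s‖ < ϱ`, `w₀ ≠ 0`,
`exp E[H_s]({0}) = 1 + H_s(X₀)` in the ENDs' own letters. [folklore] -/
theorem exp_locE_actW {ϱ : ℝ} {w₀ s : ℂ} (hs : ‖s‖ < ϱ) (hw0 : w₀ ≠ 0) :
    Complex.exp (locE (tgeometry 4 N).ι (tgeometry 4 N).cubes (actW N (cW ϱ w₀) w₀ s) ((tgeometry 4 N).cubes (X₀ N))) =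
      1 + actW N (cW ϱ w₀) w₀ s (X₀ N) :=
  exp_locE_cube N (norm_actW_X₀_lt_one N hs hw0)

/-- A nonzero complex number of norm `≤ 2` is not a period of `exp`: `exp z = 1 ⇒ z = 0` for `‖z‖ ≤ 2` (periods have norm `≥ 2π`). [folklore] -/
theorem eq_zero_of_exp_eq_one {z : ℂ} (hz : ‖z‖ ≤ 2) (h : Complex.exp z = 1) : z = 0 := by
  obtain ⟨n, hn⟩ := Complex.exp_eq_one_iff.1 h
  by_contra hne
  have hn0 : n ≠ 0 := by rintro rfl; simp at hn; exact hne hn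
  have hnorm : ‖z‖ = |(n : ℝ)| * (2 * Real.pi) := by
    rw [hn, norm_mul, Complex.norm_intCast, norm_mul, Complex.norm_I, mul_one, Complex.norm_mul,
      Complex.norm_two, Complex.norm_real, Real.norm_eq_abs, abs_of_pos Real.pi_pos]
  have h1 : (1 : ℝ) ≤ |(n : ℝ)| := by rw [← Int.cast_abs]; exact_mod_cast Int.one_le_abs hn0
  have hπ : 3 < Real.pi := Real.pi_gt_three
  nlinarith

open Classical in
/-- **GENUINE — THE ATTACHED PART MOVES WITH THE TABLE**: for every live table direction `0 < ‖w₀‖ ≤ 1` the quantity bounded by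
`attachedEnd_fires` is `≠ 0` (W24 `exp_locE_cube`: `exp E[H_s]({0}) = 1 + H_s(X₀)`, and `c·e^{w₀} = c` would force `e^{w₀} = 1`). [folklore] -/
theorem attachedEnd_live {w₀ : ℂ} (hw : ‖w₀‖ ≤ 1) (hne : w₀ ≠ 0) :
    locE (tgeometry 4 N).ι (tgeometry 4 N).cubes (actW N (cW 2 w₀) w₀ 1) ((tgeometry 4 N).cubes (X₀ N)) ≠
      locE (tgeometry 4 N).ι (tgeometry 4 N).cubes (actW N (cW 2 w₀) w₀ 0) ((tgeometry 4 N).cubes (X₀ N)) := by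
  intro heq
  have h1 := exp_locE_actW N (ϱ := 2) (w₀ := w₀) (s := 1) (by rw [norm_one]; norm_num) hne
  rw [heq, exp_locE_actW N (by rw [norm_zero]; norm_num) hne, actW_X₀, actW_X₀, one_mul, zero_mul, Complex.exp_zero, mul_one,
    add_right_inj] at h1
  have hc : (cW 2 w₀ : ℂ) ≠ 0 := by exact_mod_cast (cW_pos 2 w₀).ne'
  have h1' : (cW 2 w₀ : ℂ) * 1 = (cW 2 w₀ : ℂ) * Complex.exp w₀ := by rw [mul_one]; exact h1
  exact hne (eq_zero_of_exp_eq_one (hw.trans (by norm_num)) ((mul_right_inj' hc).1 h1').symm)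

open Classical in
/-- **GENUINE — THE μ-PART MOVES WITH THE SOURCE**: for `μ ≠ 0`, `‖μ‖ < μ₁`, and a live table direction (`w₀ ≠ 0`, `μ₁·‖w₀‖ ≤ 2`) the
quantity bounded by `muEnd_fires` is `≠ 0` (`c·e^{μ w₀} = c` would force `e^{μ w₀} = 1` with `‖μ w₀‖ ≤ 2 < 2π`). [folklore] -/
theorem muEnd_live {μ₁ : ℝ} {μ w₀ : ℂ} (hw : μ₁ * ‖w₀‖ ≤ 2) (hμ : ‖μ‖ < μ₁) (hne : μ ≠ 0) (hw0 : w₀ ≠ 0) :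
    locE (tgeometry 4 N).ι (tgeometry 4 N).cubes (actW N (cW μ₁ w₀) w₀ μ) ((tgeometry 4 N).cubes (X₀ N)) ≠
      locE (tgeometry 4 N).ι (tgeometry 4 N).cubes (actW N (cW μ₁ w₀) w₀ 0) ((tgeometry 4 N).cubes (X₀ N)) := by
  intro heq
  have h1 := exp_locE_actW N (ϱ := μ₁) (w₀ := w₀) (s := μ) hμ hw0
  rw [heq, exp_locE_actW N (by rw [norm_zero]; exact (norm_nonneg μ).trans_lt hμ) hw0, actW_X₀, actW_X₀, zero_mul,
    Complex.exp_zero, mul_one, add_right_inj] at h1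
  have hc : (cW μ₁ w₀ : ℂ) ≠ 0 := by exact_mod_cast (cW_pos μ₁ w₀).ne'
  have h1' : (cW μ₁ w₀ : ℂ) * 1 = (cW μ₁ w₀ : ℂ) * Complex.exp (μ * w₀) := by rw [mul_one]; exact h1
  have hnorm : ‖μ * w₀‖ ≤ 2 := by rw [norm_mul]; exact (mul_le_mul_of_nonneg_right hμ.le (norm_nonneg _)).trans hw
  rcases mul_eq_zero.1 (eq_zero_of_exp_eq_one hnorm ((mul_right_inj' hc).1 h1').symm) with h | h
  exacts [hne h, hw0 h]

/-- CONSISTENCY (N0p §2 `norm_act_le_of_terms` ONCE BY NAME on the datum): the (E2) majorant N0p derives from the structural shape is,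
here, `Σ_{i ∈ terms Z} |c|·e^{1·2‖w₀‖}` — `A` on `X₀`, `0` elsewhere. [folklore] -/
example {w₀ : ℂ} (hw : (2 : ℝ) * ‖w₀‖ ≤ 2) (k : ℕ) (g : ℕ → ℝ) {s : ℂ} (hs : s ∈ ball (0 : ℂ) 2) (Z : TDom 4 N) :
    ‖actW N (cW 2 w₀) w₀ s Z‖ ≤
      ∑ i ∈ terms N Z, (∫ a, ‖wPhi (cW 2 w₀) k i 0 k a‖ ∂wMeas k i 0 k) * Real.exp (1 * (2 * ‖w₀‖)) :=
  norm_act_le_of_terms (termHistExpLinear_wTerm (cW 2 w₀) (ballClass toyCtr (fun _ => 1 / 8) fun _ => 2) Set.univ)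
    (Set.mem_univ g) (U := ()) (o := 0) (hc := fun s : ℂ => s * w₀) (hK hw k g ()) (hR 2 w₀) (emb := fun _ => k)
    (fun _ => rfl) (fun s _ Z => hact N (cW 2 w₀) w₀ k s Z) (N := fun _ _ => 1) (fun _ _ => zero_le_one)
    (fun _ i _ => ae_of_all _ fun a => norm_wLam_le k i 0 k a) hs Z

end Summit.QuantumFields.BalabanUV.T4Continuum.NE1p.DressedSmallFieldOnCoresWitness

end
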